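import Summits.QuantumAdvantage.QuantumAdvantage.Theorems.CubicForrelationNearExactIsExactTwelveDigitClass
import Summits.QuantumAdvantage.QuantumAdvantage.Theorems.CubicForrelationNearExactIsExactTwelveWindowShape30
import Summits.QuantumAdvantage.QuantumAdvantage.Theorems.CubicForrelationNearExactIsExactTwelveBetaDead

/-!
# Crux `CubicForrelation.NearExactIsExact` (stmt-QuantumAdvantage-14043) — n = 12: the open window `(57/64, 29/32)` REDUCED to ONE
  one-sided statement about type-O cubics — "the digit class of a type-O cubic has at least `1280` points" (E1280)

Certificate seat `b2b-cforr-cert` (gen 33).  HONEST FRAMING: kernel-checked finite-slice theorems (standard axioms) about cubic Boolean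
functions on 12 bits; a REDUCTION of the open window of the 12-bit cubic-Forrelation slice and the structure of a hypothetical window pair.
NO new value of `θ₁₂` (`∈ [57/64, 29/32)`), NOT summit progress.  The value is a THEOREM / DECIDABLE-VERDICT bookkeeping step.

For a cubic `g : 𝔽₂¹² → 𝔽₂` of TYPE O (`W_g = 16u`, every `u` odd) put `e(g) := #{x : u(x) ≡ ±1 (mod 8)}` — the size of the DIGIT CLASS
(…TwelveDigitClass: a cubic support, `8 ∣ e`, and `e ≥ 1280 ⇒ Φ(f,g) ≤ 57/64` for every `f`).
* `tdw_window_side_light` (UNCONDITIONAL STRUCTURE): for a cubic pair with `57/64 < Φ(f,g) < 1`, BOTH sides are type O (gen 30,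
  `tz30_window_pair_typeO`) with LIGHT digit classes: `512 ≤ e ≤ 1272` (`tdw_window_pair_light`).  By THEOREM W (`tow_weight_ge_1280`,
  …TwelveOddWeight) such an `e` is moreover `≡ 0 (mod 16)` — recorded in the follow-up file …TwelveDigitWeightReductionEven once that module
  is available on the build farm; the present file does not import it.
* `isolation_twelve_57_64_of_digit_weight` / `theta_twelve_eq_57_64_of_digit_weight`: IF every type-O cubic on 12 bits has `e ≥ 1280`
  (statement `E1280`, inlined as a hypothesis; its case `e ≡ 8 (mod 16)` IS THEOREM W, the case `16 ∣ e` — "E1280-even" — is OPEN;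
  numerically the minimum of `e` is `1400`, attained by the four-disjoint-monomial class, and the PROFILE BOUND of …TwelveDigitProfile
  explains that value), THEN `57/64 < Φ ⇒ Φ = 1` on 12 bits and `θ₁₂ = 57/64` EXACTLY.  CONDITIONAL packaging: it closes nothing by itself;
  it records that the whole two-sided window analysis now hinges on the single one-sided statement E1280(-even)
  (structure for it: …TwelveDigitDualForm, …TwelveDigitPairing, …TwelveDigitNoPeriod, …TwelveDigitProfile; HOME/b2b-cforr-cert-g33/PLAN-N12-E1280.md).

References: J. Ax (1964) / R. J. McEliece (1972); T. Kasami, N. Tokura (1970); C. Carlet (2021) §4.1; R. O'Donnell (2014) §1.4.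
Axioms: the standard three.
-/

set_option linter.dupNamespace false -- D-0017: single-problem summit ⇒ `QuantumAdvantage.QuantumAdvantage` by design

noncomputable section

namespace Summit.QuantumAdvantage.QuantumAdvantage.Theorems.CubicForrelation.NearExactIsExact

open Finset
open Literature.Computability.QuantumComplexity
open Literature.Computability.QuantumComplexity.DerivativeWalsh (W)

/-! ### What is left of the window: both sides type O with a LIGHT digit class -/

/-- **Window structure after gen 33 (unconditional).**  For cubic `f, g` on 12 bits with `57/64 < Φ(f,g) < 1`: the side `g` is of
type O (`W_g = 16u`, all `u` odd — gen 30) and its digit class `e = #{u ≡ ±1 (mod 8)}` satisfies `512 ≤ e ≤ 1272`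
(`e ≥ 1280` would cap `Φ ≤ 57/64` by `tdw_forrelation_le_57_64`; `e ≥ 512` by `no_caseA` + Reed–Muller; `8 ∣ e`).
The same holds for `f` by symmetry (`tdw_window_pair_light`).  Finite-slice structure, NOT summit progress. [this work] -/
theorem tdw_window_side_light (f g : (Fin (6 + 6) → Bool) → Bool) (hf : IsDegLeFun 3 f) (hg : IsDegLeFun 3 g)
    (hlo : (57 / 64 : ℝ) < forrelation f g) (hhi : forrelation f g < 1) :
    ∃ u : (Fin (6 + 6) → Bool) → ℤ, (∀ x, W (fun y => signOf (g y)) x = (2 : ℝ) ^ 4 * (u x : ℝ)) ∧ (∀ x, Odd (u x)) ∧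
      512 ≤ #(univ.filter fun x : Fin (6 + 6) → Bool => u x % 8 = 1 ∨ u x % 8 = 7) ∧
      #(univ.filter fun x : Fin (6 + 6) → Bool => u x % 8 = 1 ∨ u x % 8 = 7) ≤ 1272 := by
  obtain ⟨-, ⟨u, hu, hodd⟩⟩ := tz30_window_pair_typeO f g hf hg hlo hhi
  refine ⟨u, hu, hodd, ?_, ?_⟩
  · -- `e ≥ 512`: the digit class is a non-empty cubic support (`no_caseA`)
    have hQ := tdw_digitClass_cubic g u hg hu hodd
    have hex : ∃ x, (fun x : Fin (6 + 6) → Bool => decide (u x % 8 = 1 ∨ u x % 8 = 7)) x = true := by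
      by_contra hnone
      push Not at hnone
      refine Summit.QuantumAdvantage.QuantumAdvantage.Theorems.NearExactIsExact.Negative.TypeOTwelve.no_caseA g u hg hu
        fun x => ?_
      have hx := hnone x
      have ho : u x % 2 = 1 := Int.odd_iff.1 (hodd x)
      simp only [Bool.not_eq_true, decide_eq_false_iff_not, not_or] at hx
      omega
    have hrm := bb_rmWeight_holds (6 + 6) 3 _ hQ hex
    have hset : (univ.filter fun x : Fin (6 + 6) → Bool => decide (u x % 8 = 1 ∨ u x % 8 = 7) = true) =
        univ.filter fun x : Fin (6 + 6) → Bool => u x % 8 = 1 ∨ u x % 8 = 7 := by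
      simp only [decide_eq_true_eq]
    rw [hset] at hrm
    have e12 : 2 ^ (6 + 6) = 2 ^ 3 * 512 := by norm_num
    rw [e12] at hrm
    exact Nat.le_of_mul_le_mul_left hrm (by norm_num)
  · -- `e ≤ 1272`: otherwise `e ≥ 1273`, `8 ∣ e` gives `e ≥ 1280` and `Φ ≤ 57/64`
    by_contra hgt
    rw [not_le] at hgt
    have h8 := tdw_e_mod8 g u hg hu hodd
    have he : 1280 ≤ #(univ.filter fun x : Fin (6 + 6) → Bool => u x % 8 = 1 ∨ u x % 8 = 7) := by omega
    have := tdw_forrelation_le_57_64 g u f hu hodd he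
    linarith

/-- Both sides of `tdw_window_side_light` (`Φ` is symmetric). [this work] -/
theorem tdw_window_pair_light (f g : (Fin (6 + 6) → Bool) → Bool) (hf : IsDegLeFun 3 f) (hg : IsDegLeFun 3 g)
    (hlo : (57 / 64 : ℝ) < forrelation f g) (hhi : forrelation f g < 1) :
    (∃ u : (Fin (6 + 6) → Bool) → ℤ, (∀ y, W (fun x => signOf (f x)) y = (2 : ℝ) ^ 4 * (u y : ℝ)) ∧ (∀ y, Odd (u y)) ∧
      512 ≤ #(univ.filter fun y : Fin (6 + 6) → Bool => u y % 8 = 1 ∨ u y % 8 = 7) ∧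
      #(univ.filter fun y : Fin (6 + 6) → Bool => u y % 8 = 1 ∨ u y % 8 = 7) ≤ 1272) ∧
    (∃ u : (Fin (6 + 6) → Bool) → ℤ, (∀ x, W (fun y => signOf (g y)) x = (2 : ℝ) ^ 4 * (u x : ℝ)) ∧ (∀ x, Odd (u x)) ∧
      512 ≤ #(univ.filter fun x : Fin (6 + 6) → Bool => u x % 8 = 1 ∨ u x % 8 = 7) ∧
      #(univ.filter fun x : Fin (6 + 6) → Bool => u x % 8 = 1 ∨ u x % 8 = 7) ≤ 1272) := by
  have hΦ' : forrelation g f = forrelation f g := by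
    rw [Summit.QuantumAdvantage.QuantumAdvantage.Theorems.SignedCubicForrelationNotPrBPP.Negative.HalfQuad.forrelation_comm]
  exact ⟨tdw_window_side_light g f hg hf (by rw [hΦ']; exact hlo) (by rw [hΦ']; exact hhi),
    tdw_window_side_light f g hf hg hlo hhi⟩

/-! ### The conditional closing of the window -/

/-- **`E1280 ⇒ isolation at 57/64` (conditional packaging).**  IF every type-O cubic `g` on 12 bits has a digit class with `e ≥ 1280`
points (hypothesis `H`, the statement `E1280`; its case `e ≡ 8 (mod 16)` is THEOREM W `tow_weight_ge_1280`, the even case is OPEN), THEN for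
all cubic `f, g` on 12 bits `57/64 < Φ(f,g) ⇒ Φ(f,g) = 1`.  (`Φ ≥ 29/32` is `isolation_twelve_ge_2932`; on `(57/64, 29/32)` the side `g` is
type O with `e ≤ 1272` by `tdw_window_side_light`, contradicting `H`.)  CONDITIONAL: closes nothing by itself; NOT summit progress.
[this work] -/
theorem isolation_twelve_57_64_of_digit_weight
    (H : ∀ (g : (Fin (6 + 6) → Bool) → Bool) (u : (Fin (6 + 6) → Bool) → ℤ), IsDegLeFun 3 g →
      (∀ x, W (fun y => signOf (g y)) x = (2 : ℝ) ^ 4 * (u x : ℝ)) → (∀ x, Odd (u x)) →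
      1280 ≤ #(univ.filter fun x : Fin (6 + 6) → Bool => u x % 8 = 1 ∨ u x % 8 = 7)) :
    ∀ f g : (Fin 12 → Bool) → Bool, IsDegLeFun 3 f → IsDegLeFun 3 g →
      (57 / 64 : ℝ) < forrelation f g → forrelation f g = 1 := by
  intro f g hf hg hlo
  by_cases h29 : (29 / 32 : ℝ) ≤ forrelation f g
  · exact isolation_twelve_ge_2932 f g hf hg h29
  · rw [not_le] at h29
    have hhi : forrelation f g < 1 := h29.trans (by norm_num)
    obtain ⟨u, hu, hodd, -, hle⟩ := tdw_window_side_light f g hf hg hlo hhi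
    have he := H g u hg hu hodd
    omega

/-- **`E1280 ⇒ θ₁₂ = 57/64` (conditional packaging).**  Under the same hypothesis, `57/64` is the LEAST isolation threshold for cubic
pairs on 12 bits (it is attained: `Φ(fC,gC) = 57/64`, `theta_twelve_bounds`).  CONDITIONAL; NOT summit progress. [this work] -/
theorem theta_twelve_eq_57_64_of_digit_weight
    (H : ∀ (g : (Fin (6 + 6) → Bool) → Bool) (u : (Fin (6 + 6) → Bool) → ℤ), IsDegLeFun 3 g →
      (∀ x, W (fun y => signOf (g y)) x = (2 : ℝ) ^ 4 * (u x : ℝ)) → (∀ x, Odd (u x)) →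
      1280 ≤ #(univ.filter fun x : Fin (6 + 6) → Bool => u x % 8 = 1 ∨ u x % 8 = 7)) :
    IsLeast {θ : ℝ | ∀ f g : (Fin 12 → Bool) → Bool, IsDegLeFun 3 f → IsDegLeFun 3 g →
      θ < forrelation f g → forrelation f g = 1} (57 / 64) :=
  ⟨isolation_twelve_57_64_of_digit_weight H, fun θ hθ => theta_twelve_bounds.2 θ hθ⟩

end Summit.QuantumAdvantage.QuantumAdvantage.Theorems.CubicForrelation.NearExactIsExact

end
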